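import Mathlib
import HarnessLib
import Literature.Geometry.Lorentzian.CoordCurvature
import Literature.Geometry.Lorentzian.KerrSchild

/-!
# Route TemporalBandLiouville — support item `TargetOfCruxes` (stmt-FinalStateConjecture-10174)

Pure logic. The route's two cruxes
* C1 = `BandFromNonradiation` — an eternal, two-sided `C^k`-bounded, non-radiating harmonic-gauge
  vacuum exterior `G` on the excised cylinder `Kerr.region a r₀` is band-limited in `t` (every
  component `s ↦ G (x + s e₀) v w` is the restriction of an entire function of exponential type), and
* C2 = `BandLimitedLiouville` — the same hypotheses plus such a temporal band force `t`-independence,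

compose to the route target X = `EternalExteriorStationary` (such `G` is `t`-independent), because the
three hypothesis bundles are syntactically identical and the conclusion of C1 is literally the extra
hypothesis of C2. So `TargetOfCruxes : BandFromNonradiation → BandLimitedLiouville →
EternalExteriorStationary` is two applications of modus ponens.

Design (pattern of `Theorems/EIHFluxBalanceAssemblyFrame.lean`,
`Theorems/PhotonSphereChannelsFarChannels.lean`): this module does NOT import the route module
`Summits.FinalStateConjecture.FinalStateConjecture.Theses.TemporalBandLiouville`. When the item
closes, the gate re-renders the route file with `import <this module>` and
`theorem TargetOfCruxes_holds : TargetOfCruxes := …`; a closing module importing the route file would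
make that an import cycle. Hence the theorem below states the three bodies VERBATIM (copied from the
route file rev 2, names shortened under a term-level `open Literature.Geometry.Lorentzian in`), so its
type is the route decl `…Theses.TemporalBandLiouville.TargetOfCruxes` up to `δ`-unfolding of the four
route definitions, and nothing else.

Nothing mathematical is used or claimed here; in particular neither crux is proved.
-/

namespace Summit.FinalStateConjecture.FinalStateConjecture.Theorems

/-- **`TargetOfCruxes` of route TemporalBandLiouville** (item stmt-FinalStateConjecture-10174):
`BandFromNonradiation → BandLimitedLiouville → EternalExteriorStationary`, the three route
definitions written out verbatim (first antecedent = C1 "band from non-radiation", second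
antecedent = C2 "band-limited Liouville", conclusion = X "eternal harmonic-gauge vacuum exteriors
are stationary"), so that this type `δ`-unfolds to
`Summit.FinalStateConjecture.FinalStateConjecture.Theses.TemporalBandLiouville.TargetOfCruxes`.
Proof: given the hypothesis bundle `hG` of X for `(a, r₀, G)`, C1 yields the temporal band
`hB a r₀ G hG`, and C2 applied to the same bundle and that band yields `t`-independence. -/
theorem TemporalBandLiouville.targetOfCruxes_proof :
    open Literature.Geometry.Lorentzian in
      (∀ (a r₀ : ℝ) (G : E4 → E4 →L[ℝ] E4 →L[ℝ] ℝ), (0 < r₀ ∧ MetricCoord.IsMetricOn G (Kerr.region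
            a r₀ : Set E4)
        ∧ (∃ c₀ δ : ℝ, 0 < c₀ ∧ 0 < δ ∧ ∀ x ∈ Kerr.region a r₀, (E4.dx 0) (MetricCoord.sharpAt G x
            (E4.dx 0)) ≤ -c₀ ∧ (Kerr.radius a x < r₀ + δ → (fderiv ℝ (Kerr.radius a) x)
            (MetricCoord.sharpAt G x (fderiv ℝ (Kerr.radius a) x)) ≤ -c₀ ∧ c₀ ≤ (E4.dx 0)
            (MetricCoord.sharpAt G x (fderiv ℝ (Kerr.radius a) x))))
        ∧ (∀ x ∈ Kerr.region a r₀, MetricCoord.ricAt G x = 0)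
        ∧ (∀ x ∈ Kerr.region a r₀, ∑ β : Fin 4, MetricCoord.chrAt G x (MetricCoord.sharpAt G x
            (E4.dx β)) (E4.basisVector β) = 0)
        ∧ (∀ k : ℕ, ∃ C : ℝ, ∀ x ∈ Kerr.region a r₀, ‖iteratedFDeriv ℝ k G x‖ ≤ C ∧
            ‖MetricCoord.sharpAt G x‖ ≤ C)
        ∧ (∃ C : ℝ, ∀ x ∈ Kerr.region a r₀, ‖G x - Minkowski.bilin‖ ≤ C / E4.spatialNorm x ∧
            ‖iteratedFDeriv ℝ 1 G x‖ ≤ C / E4.spatialNorm x ^ 2 ∧ ‖iteratedFDeriv ℝ 2 G x‖ ≤ C /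
            E4.spatialNorm x ^ 3))
        → (∃ b C : ℝ, ∀ x ∈ Kerr.region a r₀, ∀ v w : E4, ∃ F : ℂ → ℂ, Differentiable ℂ F ∧ (∀ z :
            ℂ, ‖F z‖ ≤ C * ‖v‖ * ‖w‖ * Real.exp (b * |z.im|)) ∧ ∀ s : ℝ, F (s : ℂ) = ((G (x + s •
            E4.basisVector 0) v w : ℝ) : ℂ))) →
      (∀ (a r₀ : ℝ) (G : E4 → E4 →L[ℝ] E4 →L[ℝ] ℝ), (0 < r₀ ∧ MetricCoord.IsMetricOn G (Kerr.region
            a r₀ : Set E4)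
        ∧ (∃ c₀ δ : ℝ, 0 < c₀ ∧ 0 < δ ∧ ∀ x ∈ Kerr.region a r₀, (E4.dx 0) (MetricCoord.sharpAt G x
            (E4.dx 0)) ≤ -c₀ ∧ (Kerr.radius a x < r₀ + δ → (fderiv ℝ (Kerr.radius a) x)
            (MetricCoord.sharpAt G x (fderiv ℝ (Kerr.radius a) x)) ≤ -c₀ ∧ c₀ ≤ (E4.dx 0)
            (MetricCoord.sharpAt G x (fderiv ℝ (Kerr.radius a) x))))
        ∧ (∀ x ∈ Kerr.region a r₀, MetricCoord.ricAt G x = 0)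
        ∧ (∀ x ∈ Kerr.region a r₀, ∑ β : Fin 4, MetricCoord.chrAt G x (MetricCoord.sharpAt G x
            (E4.dx β)) (E4.basisVector β) = 0)
        ∧ (∀ k : ℕ, ∃ C : ℝ, ∀ x ∈ Kerr.region a r₀, ‖iteratedFDeriv ℝ k G x‖ ≤ C ∧
            ‖MetricCoord.sharpAt G x‖ ≤ C)
        ∧ (∃ C : ℝ, ∀ x ∈ Kerr.region a r₀, ‖G x - Minkowski.bilin‖ ≤ C / E4.spatialNorm x ∧
            ‖iteratedFDeriv ℝ 1 G x‖ ≤ C / E4.spatialNorm x ^ 2 ∧ ‖iteratedFDeriv ℝ 2 G x‖ ≤ C /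
            E4.spatialNorm x ^ 3))
        → (∃ b C : ℝ, ∀ x ∈ Kerr.region a r₀, ∀ v w : E4, ∃ F : ℂ → ℂ, Differentiable ℂ F ∧ (∀ z :
            ℂ, ‖F z‖ ≤ C * ‖v‖ * ‖w‖ * Real.exp (b * |z.im|)) ∧ ∀ s : ℝ, F (s : ℂ) = ((G (x + s •
            E4.basisVector 0) v w : ℝ) : ℂ))
        → ∀ x ∈ Kerr.region a r₀, ∀ s : ℝ, G (x + s • E4.basisVector 0) = G x) →
      (∀ (a r₀ : ℝ) (G : E4 → E4 →L[ℝ] E4 →L[ℝ] ℝ), (0 < r₀ ∧ MetricCoord.IsMetricOn G (Kerr.region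
            a r₀ : Set E4)
        ∧ (∃ c₀ δ : ℝ, 0 < c₀ ∧ 0 < δ ∧ ∀ x ∈ Kerr.region a r₀, (E4.dx 0) (MetricCoord.sharpAt G x
            (E4.dx 0)) ≤ -c₀ ∧ (Kerr.radius a x < r₀ + δ → (fderiv ℝ (Kerr.radius a) x)
            (MetricCoord.sharpAt G x (fderiv ℝ (Kerr.radius a) x)) ≤ -c₀ ∧ c₀ ≤ (E4.dx 0)
            (MetricCoord.sharpAt G x (fderiv ℝ (Kerr.radius a) x))))
        ∧ (∀ x ∈ Kerr.region a r₀, MetricCoord.ricAt G x = 0)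
        ∧ (∀ x ∈ Kerr.region a r₀, ∑ β : Fin 4, MetricCoord.chrAt G x (MetricCoord.sharpAt G x
            (E4.dx β)) (E4.basisVector β) = 0)
        ∧ (∀ k : ℕ, ∃ C : ℝ, ∀ x ∈ Kerr.region a r₀, ‖iteratedFDeriv ℝ k G x‖ ≤ C ∧
            ‖MetricCoord.sharpAt G x‖ ≤ C)
        ∧ (∃ C : ℝ, ∀ x ∈ Kerr.region a r₀, ‖G x - Minkowski.bilin‖ ≤ C / E4.spatialNorm x ∧
            ‖iteratedFDeriv ℝ 1 G x‖ ≤ C / E4.spatialNorm x ^ 2 ∧ ‖iteratedFDeriv ℝ 2 G x‖ ≤ C /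
            E4.spatialNorm x ^ 3))
        → ∀ x ∈ Kerr.region a r₀, ∀ s : ℝ, G (x + s • E4.basisVector 0) = G x) := by
  intro hB hL a r₀ G hG
  exact hL a r₀ G hG (hB a r₀ G hG)

end Summit.FinalStateConjecture.FinalStateConjecture.Theorems
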